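import Summits.ABC.ABC.Theses.IneffectiveSubspace
import Summits.ABC.ABC.Theorems.IneffectiveSubspaceTowerFourGivesDepthCounted

/-!
# `UniformSadicTowerFour` (stmt-ABC-14937), line `Sketch`: crux at `S` ⟹ mixed-radical normal form at `S`

The stub `stub_mixed_of_tower_at` of the line `Sketch` (card `mixed-radical-exchange-map`).

**Statement.** Fix `C, ε : ℝ` and a finite set `S ⊆ ℕ`. Suppose the crux inequality holds at `S` for
every positive coprime level-4 tower point: for all `x y z : Fin 4 → ℕ` with all entries positive,
`a + b = c` and `Coprime a b` where `a := ∏ xᵢ^(i+1)`, `b := ∏ yᵢ^(i+1)`, `c := ∏ zᵢ^(i+1)`, one has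
`c < C · ((∏_{p ∈ S} p) · {M}^S)^(1+ε)`, `M := ∏ xᵢyᵢzᵢ`, `{M}^S := ∏_{p ∣ M, p ∉ S} p^{v_p(M)}` the
`S`-free part. Then the MIXED inequality with the same `C, ε, S` holds for every abc triple `(a, b, c)`:
`c < C · M_S(abc)^(1+ε)`, `M_S(m) := (∏_{p ∈ S} p) · ∏_{p ∣ m, p ∉ S} p^⌈v_p(m)/4⌉`, `⌈v/4⌉ = (v+3)/4`.

**Proof** (optimal lifts, Vojta 2000 §3.1 at level `4`). Lift `a, b, c` optimally to level `4`
(`TowerFourGivesDepthCounted.exists_lift`: `∏ xᵢ^(i+1) = a`, all `xᵢ ≥ 1`, `v_p(∏ xᵢ) = ⌈v_p(a)/4⌉`,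
and likewise for `b, c`). The triple is pairwise coprime, so for every prime `p` at most one of
`v_p(a), v_p(b), v_p(c)` is nonzero and `v_p(∏ xᵢyᵢzᵢ) = ⌈v_p(a)/4⌉ + ⌈v_p(b)/4⌉ + ⌈v_p(c)/4⌉ =
⌈v_p(abc)/4⌉`; in particular `∏ xᵢyᵢzᵢ` and `abc` have the same prime factors. Hence the bracket
`(∏_{p ∈ S} p) · {∏ xᵢyᵢzᵢ}^S` fed back by the crux at the lifted point IS `M_S(abc)` — an equality, so no
primality of the elements of `S` and no sign condition on `C` or `ε` is needed.

Sources: card mixed-radical-exchange-map (crux stmt-ABC-14937, line Sketch); Vojta 2000 §3.1 (optimal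
lifts) [Vojta2000ABC], as landed in `Theorems/IneffectiveSubspaceTowerFourGivesDepthCounted.lean`
(`TowerFourGivesDepthCounted.exists_lift`, `TowerFourGivesDepthCounted.factorization_eq_zero_or`), of whose
main proof this file is a small variation (arbitrary `S` instead of the deep primes). Mathlib only
otherwise (`Nat.factorization_mul`, `Nat.support_factorization`, `Finset.prod_congr`). Deliberately NOT
here: the converse direction (neighbouring stub `stub_tower_of_mixed_at`) and the other stubs of the line.
-/

-- `Summit.<Summit>.<Problem>` is the mandated summit-side namespace (CONVENTIONS §2); for the
-- single-conjunct summit `ABC` the two coincide, so the duplicate `ABC.ABC` is deliberate.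
set_option linter.dupNamespace false

namespace Summit.ABC.ABC.Theorems.UniformSadicTowerFour.MixedRadical

open Literature.NumberTheory.DiophantineGeometry (IsABCTriple rad rad_def)
open Summit.ABC.ABC.Theses.IneffectiveSubspace
open scoped BigOperators

/-- **Lifted valuations.** If `x, y, z : Fin 4 → ℕ` are positive optimal level-4 lifts of a pairwise
coprime triple `a, b, c ≠ 0` (`v_p(∏ xᵢ) = ⌈v_p(a)/4⌉` etc.), then
`v_p(∏ xᵢyᵢzᵢ) = ⌈v_p(abc)/4⌉` for every `p`. [cite: Vojta2000ABC, §3.1] -/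
theorem mixedOfTower_factorization_prod {a b c : ℕ} {x y z : Fin 4 → ℕ}
    (ha : a ≠ 0) (hb : b ≠ 0) (hc : c ≠ 0)
    (hab : Nat.Coprime a b) (hac : Nat.Coprime a c) (hbc : Nat.Coprime b c)
    (hx0 : ∀ i, 0 < x i) (hy0 : ∀ i, 0 < y i) (hz0 : ∀ i, 0 < z i)
    (hxf : ∀ p, (∏ i, x i).factorization p = (a.factorization p + 3) / 4)
    (hyf : ∀ p, (∏ i, y i).factorization p = (b.factorization p + 3) / 4)
    (hzf : ∀ p, (∏ i, z i).factorization p = (c.factorization p + 3) / 4) (p : ℕ) :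
    (∏ i, x i * y i * z i).factorization p = ((a * b * c).factorization p + 3) / 4 := by
  have hx' : (∏ i, x i) ≠ 0 := (Finset.prod_pos fun i _ => hx0 i).ne'
  have hy' : (∏ i, y i) ≠ 0 := (Finset.prod_pos fun i _ => hy0 i).ne'
  have hz' : (∏ i, z i) ≠ 0 := (Finset.prod_pos fun i _ => hz0 i).ne'
  rw [Finset.prod_mul_distrib, Finset.prod_mul_distrib,
    Nat.factorization_mul (mul_ne_zero hx' hy') hz', Nat.factorization_mul hx' hy',
    Nat.factorization_mul (mul_ne_zero ha hb) hc, Nat.factorization_mul ha hb]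
  simp only [Finsupp.add_apply, hxf, hyf, hzf]
  rcases TowerFourGivesDepthCounted.factorization_eq_zero_or hab p with h1 | h1 <;>
  rcases TowerFourGivesDepthCounted.factorization_eq_zero_or hac p with h2 | h2 <;>
  rcases TowerFourGivesDepthCounted.factorization_eq_zero_or hbc p with h3 | h3 <;>
  omega

/-- **The bracket is the mixed radical.** If `v_p(M) = ⌈v_p(m)/4⌉` for every `p`, then `M` and `m`
have the same prime factors and, for every finite `S ⊆ ℕ`,
`(∏_{p ∈ S} p) · ∏_{p ∣ M, p ∉ S} p^{v_p(M)} = (∏_{p ∈ S} p) · ∏_{p ∣ m, p ∉ S} p^⌈v_p(m)/4⌉`. [folklore] -/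
theorem mixedOfTower_bracket_eq {M m : ℕ} (S : Finset ℕ)
    (hf : ∀ p, M.factorization p = (m.factorization p + 3) / 4) :
    (∏ p ∈ S, p) * ∏ p ∈ M.primeFactors \ S, p ^ M.factorization p =
      (∏ p ∈ S, p) * ∏ p ∈ m.primeFactors \ S, p ^ ((m.factorization p + 3) / 4) := by
  have hpf : M.primeFactors = m.primeFactors := by
    ext p
    rw [← Nat.support_factorization, ← Nat.support_factorization, Finsupp.mem_support_iff,
      Finsupp.mem_support_iff, hf]
    constructor <;> intro h <;> omega
  rw [hpf]
  exact congrArg _ (Finset.prod_congr rfl fun p _ => by rw [hf])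

/-- **stub_mixed_of_tower_at (crux ⟹ normal form, one `S` at a time; optimal lifts).** If the crux
inequality with constant `C` and exponent `1+ε` holds at `S` for every positive coprime level-4 tower point,
then the mixed inequality with the same `C, ε, S` holds for every abc triple: lift `a, b, c` optimally
(`TowerFourGivesDepthCounted.exists_lift`: `∏ xᵢ^(i+1) = a`, `v_p(∏ xᵢ) = ⌈v_p(a)/4⌉`); by coprimality
`v_p(∏ xᵢyᵢzᵢ) = ⌈v_p(abc)/4⌉`, so `(∏_{p∈S} p) · {∏ xᵢyᵢzᵢ}^S = M_S(abc)` on the nose.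
[cite: Vojta2000ABC, §3.1] -/
theorem stub_mixed_of_tower_at {C ε : ℝ} {S : Finset ℕ}
    (h : ∀ x y z : Fin 4 → ℕ, (∀ i, 0 < x i ∧ 0 < y i ∧ 0 < z i) →
      (∏ i, x i ^ (i.val + 1)) + (∏ i, y i ^ (i.val + 1)) = ∏ i, z i ^ (i.val + 1) →
      Nat.Coprime (∏ i, x i ^ (i.val + 1)) (∏ i, y i ^ (i.val + 1)) →
      ((∏ i, z i ^ (i.val + 1) : ℕ) : ℝ) < C * (((∏ p ∈ S, p) *
        ∏ p ∈ (∏ i, x i * y i * z i).primeFactors \ S, p ^ (∏ i, x i * y i * z i).factorization p : ℕ) :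
          ℝ) ^ (1 + ε)) :
    ∀ a b c : ℕ, IsABCTriple a b c →
      (c : ℝ) < C * ((((∏ p ∈ S, p) *
        ∏ p ∈ (a * b * c).primeFactors \ S, p ^ (((a * b * c).factorization p + 3) / 4) : ℕ) : ℝ)) ^
          (1 + ε) := by
  intro a b c habc
  obtain ⟨ha, hb, hsum, hcop⟩ := habc
  have hc : 0 < c := by omega
  -- optimal level-4 lifts of `a, b, c`
  obtain ⟨x, hx0, hxa, hxf⟩ := TowerFourGivesDepthCounted.exists_lift ha.ne'
  obtain ⟨y, hy0, hyb, hyf⟩ := TowerFourGivesDepthCounted.exists_lift hb.ne'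
  obtain ⟨z, hz0, hzc, hzf⟩ := TowerFourGivesDepthCounted.exists_lift hc.ne'
  -- the two other coprimalities of the triple
  have hac : Nat.Coprime a c := by
    rw [← hsum]; exact Nat.coprime_self_add_right.mpr hcop
  have hbc : Nat.Coprime b c := by
    rw [← hsum]; exact Nat.coprime_add_self_right.mpr hcop.symm
  -- valuations of the lifted point: `v_p(∏ xᵢyᵢzᵢ) = ⌈v_p(abc)/4⌉`
  have hPfac : ∀ p, (∏ i, x i * y i * z i).factorization p =
      ((a * b * c).factorization p + 3) / 4 :=
    mixedOfTower_factorization_prod ha.ne' hb.ne' hc.ne' hcop hac hbc hx0 hy0 hz0 hxf hyf hzf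
  -- feed the lifted point to the crux at `S` and identify the bracket with `M_S(abc)`
  have key := h x y z (fun i => ⟨hx0 i, hy0 i, hz0 i⟩)
    (by rw [hxa, hyb, hzc]; exact hsum) (by rw [hxa, hyb]; exact hcop)
  rw [hzc, mixedOfTower_bracket_eq S hPfac] at key
  exact key

end Summit.ABC.ABC.Theorems.UniformSadicTowerFour.MixedRadical
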